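import Mathlib
import Literature.MathematicalPhysics.QuantumLattice.WilsonDiracAP

/-!
# Cell–plaquette incidence on the four-torus
(helper for crux stmt-QuantumFields-9734, line `Sketch`, stub `stub_cellIncidence`)

Finite combinatorics on `(ℤ/Lℤ)⁴`, `L ≥ 2`.  A plaquette `p = (b; μ < ν)` belongs to the closed unit
cell with lowest corner `c` (`inCell c p`) iff `b_μ = c_μ`, `b_ν = c_ν` and `b_λ ∈ {c_λ, c_λ + 1}` for
the two transverse directions `λ ∉ {μ, ν}`.  We prove (i) every cell contains at most `24` plaquettes,
by injecting the plaquettes of a cell into `{planes} × Bool × Bool` (`6 · 2 · 2 = 24`: the plane and,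
for each of the two transverse directions, whether the base point sits at `c_λ` or at `c_λ + 1`), and
(ii) every plaquette lies in exactly `4` cells, by exhibiting the cells containing `(b; μ < ν)` as the
injective image of `Bool × Bool` (`c_λ ∈ {b_λ, b_λ - 1}` for the two transverse `λ`; injectivity uses
`(1 : ZMod L) ≠ 0`, i.e. `L ≥ 2`).  The two transverse directions of a plane are provided by a
decidable existence statement over `Fin 4`.  Mathlib only; no new definitions.
-/

noncomputable section

open scoped BigOperators Classical Matrix ComplexConjugate
open Finset
open Literature.MathematicalPhysics.QuantumLattice Literature.MathematicalPhysics.QuantumFieldTheory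
  Literature.Probability.LatticeModels

namespace Summit.QuantumFields.QCD.Cruxes.CriticalLineDiamagnetism.ChessboardCellGain

/-- For every coordinate plane `μ < ν` of `Fin 4` there are two distinct transverse directions
`a ≠ b`, both different from `μ` and `ν`, and every direction other than `μ, ν` is one of them. -/
theorem transverse_pair_exists :
    ∀ μ ν : Fin 4, μ < ν → ∃ a b : Fin 4, a ≠ b ∧ a ≠ μ ∧ a ≠ ν ∧ b ≠ μ ∧ b ≠ ν ∧
      ∀ κ : Fin 4, κ ≠ μ → κ ≠ ν → (κ = a ∨ κ = b) := by
  decide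

/-- If `x ≠ y`, a Boolean is determined by the value it selects among `x` and `y`. -/
theorem bool_eq_of_ite_eq {α : Type*} {x y : α} (hxy : x ≠ y) {s t : Bool}
    (h : (if s = true then x else y) = (if t = true then x else y)) : s = t := by
  cases s <;> cases t <;> simp_all

/-- **A closed unit cell has at most 24 plaquettes.** If every plaquette of `S` lies in the closed
unit cell with lowest corner `c` (base point equal to `c` in the two plane directions and equal to
`c` or `c + 1` in the two transverse directions), then `#S ≤ 24`: the map
`p ↦ (plane, [b_a = c_a], [b_b = c_b])` (`a, b` the transverse directions) is injective on `S`
and lands in a set of cardinality `6 · 2 · 2`. -/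
theorem card_le_of_subset_cell {L : ℕ} (c : Site 4 L) (S : Finset (Plaquette 4 L))
    (hS : ∀ p ∈ S, p.1 p.2.1.1 = c p.2.1.1 ∧ p.1 p.2.1.2 = c p.2.1.2 ∧
      ∀ κ, κ ≠ p.2.1.1 → κ ≠ p.2.1.2 → (p.1 κ = c κ ∨ p.1 κ = c κ + 1)) :
    S.card ≤ 24 := by
  choose ta tb hspec using transverse_pair_exists
  -- there are exactly six coordinate planes `μ < ν` in four dimensions
  have hP : Fintype.card {q : Fin 4 × Fin 4 // q.1 < q.2} = 6 := by decide
  have hT : (univ : Finset ({q : Fin 4 × Fin 4 // q.1 < q.2} × Bool × Bool)).card = 24 := by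
    rw [Finset.card_univ, Fintype.card_prod, Fintype.card_prod, Fintype.card_bool, hP]
  rw [← hT]
  refine Finset.card_le_card_of_injOn
    (fun p => (p.2, decide (p.1 (ta p.2.1.1 p.2.1.2 p.2.2) = c (ta p.2.1.1 p.2.1.2 p.2.2)),
      decide (p.1 (tb p.2.1.1 p.2.1.2 p.2.2) = c (tb p.2.1.1 p.2.1.2 p.2.2))))
    (fun p _ => Finset.mem_coe.2 (Finset.mem_univ _)) ?_
  rintro ⟨b, q⟩ hp ⟨b', q'⟩ hp' heq
  obtain ⟨hp1, hp2, hp3⟩ := hS _ hp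
  obtain ⟨hp1', hp2', hp3'⟩ := hS _ hp'
  simp only [Prod.mk.injEq, decide_eq_decide] at heq
  obtain ⟨hq, hda, hdb⟩ := heq
  subst hq
  obtain ⟨-, haμ, haν, hbμ, hbν, hcov⟩ := hspec q.1.1 q.1.2 q.2
  refine Prod.ext ?_ rfl
  funext κ
  by_cases hκμ : κ = q.1.1
  · rw [hκμ]; exact hp1.trans hp1'.symm
  by_cases hκν : κ = q.1.2
  · rw [hκν]; exact hp2.trans hp2'.symm
  rcases hcov κ hκμ hκν with rfl | rfl
  · rcases hp3' _ haμ haν with h' | h'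
    · exact (hda.mpr h').trans h'.symm
    · rcases hp3 _ haμ haν with h | h
      · exact h.trans (hda.mp h).symm
      · exact h.trans h'.symm
  · rcases hp3' _ hbμ hbν with h' | h'
    · exact (hdb.mpr h').trans h'.symm
    · rcases hp3 _ hbμ hbν with h | h
      · exact h.trans (hdb.mp h).symm
      · exact h.trans h'.symm

/-- **A plaquette lies in exactly 4 closed unit cells (`L ≥ 2`).** If `S` is the set of lowest
corners `c` of the closed unit cells containing the plaquette `p = (b; μ < ν)`, then `#S = 4`:
`S` is the injective image of `Bool × Bool` under `s ↦ (c_a, c_b) = (b_a - [s.1], b_b - [s.2])`,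
`c = b` in the other directions (`a, b` the transverse directions; injective since `1 ≠ 0` in
`ZMod L`). -/
theorem card_eq_four_of_cells {L : ℕ} [NeZero L] (hL : 2 ≤ L) (p : Plaquette 4 L)
    (S : Finset (Site 4 L))
    (hS : ∀ c, c ∈ S ↔ (p.1 p.2.1.1 = c p.2.1.1 ∧ p.1 p.2.1.2 = c p.2.1.2 ∧
      ∀ κ, κ ≠ p.2.1.1 → κ ≠ p.2.1.2 → (p.1 κ = c κ ∨ p.1 κ = c κ + 1))) :
    S.card = 4 := by
  haveI : Fact (1 < L) := ⟨hL⟩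
  have h10 : (1 : ZMod L) ≠ 0 := one_ne_zero
  obtain ⟨b, q⟩ := p
  dsimp only at hS
  obtain ⟨α, β, hab, haμ, haν, hbμ, hbν, hcov⟩ := transverse_pair_exists q.1.1 q.1.2 q.2
  -- the four cells, parametrised by `Bool × Bool`
  obtain ⟨g, hg⟩ : ∃ g : Bool × Bool → Site 4 L, ∀ s κ,
      g s κ = if (κ = α ∧ s.1 = true) ∨ (κ = β ∧ s.2 = true) then b κ - 1 else b κ :=
    ⟨fun s κ => if (κ = α ∧ s.1 = true) ∨ (κ = β ∧ s.2 = true) then b κ - 1 else b κ,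
      fun _ _ => rfl⟩
  have hgα : ∀ s, g s α = if s.1 = true then b α - 1 else b α := by
    intro s; rw [hg]; simp [hab]
  have hgβ : ∀ s, g s β = if s.2 = true then b β - 1 else b β := by
    intro s; rw [hg]; simp [hab.symm]
  have hgo : ∀ s κ, κ ≠ α → κ ≠ β → g s κ = b κ := by
    intro s κ h1 h2; rw [hg]; simp [h1, h2]
  have hgval : ∀ s κ, b κ = g s κ ∨ b κ = g s κ + 1 := by
    intro s κ; rw [hg]
    split_ifs
    · exact Or.inr (sub_add_cancel (b κ) 1).symm
    · exact Or.inl rfl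
  have hne : ∀ κ, b κ - 1 ≠ b κ := fun κ h => h10 (sub_eq_self.mp h)
  have hginj : Function.Injective g := by
    rintro ⟨s1, s2⟩ ⟨t1, t2⟩ h
    have e1 := congr_fun h α
    rw [hgα, hgα] at e1
    have e2 := congr_fun h β
    rw [hgβ, hgβ] at e2
    have h1 : s1 = t1 := bool_eq_of_ite_eq (hne α) e1
    have h2 : s2 = t2 := bool_eq_of_ite_eq (hne β) e2
    rw [h1, h2]
  have hSeq : S = Finset.univ.image g := by
    ext c
    rw [hS, Finset.mem_image]
    constructor
    · rintro ⟨h1, h2, h3⟩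
      refine ⟨(decide (b α ≠ c α), decide (b β ≠ c β)), Finset.mem_univ _, ?_⟩
      funext κ
      by_cases hκα : κ = α
      · rw [hκα, hgα]
        dsimp only
        by_cases hbc : b α = c α
        · rw [decide_eq_false (not_not_intro hbc), if_neg Bool.false_ne_true]
          exact hbc
        · rw [decide_eq_true hbc, if_pos rfl]
          rcases h3 α haμ haν with h | h
          · exact absurd h hbc
          · rw [h]; exact add_sub_cancel_right _ _
      by_cases hκβ : κ = β
      · rw [hκβ, hgβ]
        dsimp only
        by_cases hbc : b β = c β
        · rw [decide_eq_false (not_not_intro hbc), if_neg Bool.false_ne_true]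
          exact hbc
        · rw [decide_eq_true hbc, if_pos rfl]
          rcases h3 β hbμ hbν with h | h
          · exact absurd h hbc
          · rw [h]; exact add_sub_cancel_right _ _
      rw [hgo _ κ hκα hκβ]
      by_cases hκμ : κ = q.1.1
      · rw [hκμ]; exact h1
      by_cases hκν : κ = q.1.2
      · rw [hκν]; exact h2
      exact ((hcov κ hκμ hκν).elim hκα hκβ).elim
    · rintro ⟨s, -, rfl⟩
      exact ⟨(hgo s _ haμ.symm hbμ.symm).symm, (hgo s _ haν.symm hbν.symm).symm,
        fun κ _ _ => hgval s κ⟩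
  rw [hSeq, Finset.card_image_of_injective _ hginj, Finset.card_univ, Fintype.card_prod,
    Fintype.card_bool]

/-- **Stub 6 — `cellIncidence` (finite combinatorics on `(ℤ/L)⁴`, `L ≥ 2`).** The closed unit cell
with lowest corner `c` has at most 24 plaquettes (`6` planes × `2 × 2` positions of the two transverse
coordinates), and every plaquette `(b; μ, ν)` of the torus lies in exactly 4 closed unit cells
(`c_μ = b_μ`, `c_ν = b_ν`, `c_λ ∈ {b_λ, b_λ − 1}` for the two `λ ∉ {μ, ν}`; distinct once `L ≥ 2`). -/
theorem stub_cellIncidence :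
    ∀ (L : ℕ) [NeZero L], 2 ≤ L →
    let inCell : Site 4 L → Plaquette 4 L → Prop := fun c p =>
      p.1 p.2.1.1 = c p.2.1.1 ∧ p.1 p.2.1.2 = c p.2.1.2 ∧
        ∀ ν, ν ≠ p.2.1.1 → ν ≠ p.2.1.2 → (p.1 ν = c ν ∨ p.1 ν = c ν + 1);
    (∀ c : Site 4 L, (univ.filter (fun p => inCell c p)).card ≤ 24) ∧
      (∀ p : Plaquette 4 L, (univ.filter (fun c => inCell c p)).card = 4) := by
  intro L _ hL
  dsimp only
  refine ⟨fun c => ?_, fun p => ?_⟩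
  · exact card_le_of_subset_cell c _ (fun p hp => (Finset.mem_filter.mp hp).2)
  · exact card_eq_four_of_cells hL p _
      (fun c => ⟨fun h => (Finset.mem_filter.mp h).2, fun h => Finset.mem_filter.mpr ⟨mem_univ _, h⟩⟩)

end Summit.QuantumFields.QCD.Cruxes.CriticalLineDiamagnetism.ChessboardCellGain

end
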